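import Mathlib

/-!
# `BoxSumToEta` (route OctantEntropy, item stmt-CriticalPhenomena-5737), part 1: the Tauberian core

Helper file for `OctantEntropyBoxSumToEta` (which closes the item): the real-analysis core, with no
lattice content (pure Mathlib).

* `eventually_add_le_of_tendsto_div` — if `b K / K → c > 0` and `J_k ≥ (1+ε) K_k → ∞` (`ε > 0`), then
  eventually `b (K_k) + M ≤ b (J_k)` (doubling along a linearly growing sequence of scales);
* `tendsto_log_div_of_windowSum` — for positive sequences `S`, `g` with `log S_K / K → s log 2`,
  `s > 0`, the averaged upper bound `g(k+2) 2^{3(k+1)} ≤ S_{k+1}` and the shell lower bound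
  `S_J ≤ S_{k+2} + 2^{3(J+2)} g(k)` (all `k, J`) force `log g(k) / k → (s-3) log 2` (upper bound
  directly; lower bound with `J = ⌈(1+ε)(k+4)⌉`, so that `S_J ≥ 2 S_{k+4}` eventually, then `ε → 0`).

In the application `S_K` is the dyadic-window sum of the critical Ising two-point function on `ℤ³`
and `g(k)` its value at the axis point `2^k e₁`; both bounds are Messager–Miracle-Solé comparisons.
-/

noncomputable section

open Filter Topology

namespace Summit.CriticalPhenomena.Ising3DConformalLimit.Theorems

/-! ### Real analysis -/

/-- **Doubling along a linearly growing sequence.** If `b K / K → c > 0` and `J_k ≥ (1+ε) K_k` with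
`K_k → ∞` (`ε > 0`), then eventually `b (K_k) + M ≤ b (J_k)`, for any fixed `M`. [folklore] -/
theorem eventually_add_le_of_tendsto_div {b : ℕ → ℝ} {c ε : ℝ} (M : ℝ)
    (hb : Tendsto (fun K : ℕ => b K / K) atTop (𝓝 c)) (hc : 0 < c) (hε : 0 < ε)
    {Kseq Jseq : ℕ → ℕ} (hK : Tendsto Kseq atTop atTop)
    (hJ : ∀ k, (1 + ε) * (Kseq k : ℝ) ≤ Jseq k) :
    ∀ᶠ k in atTop, b (Kseq k) + M ≤ b (Jseq k) := by
  set δ : ℝ := c * ε / (2 * (2 + ε)) with hδ_def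
  have hδpos : 0 < δ := by positivity
  have hδε : δ * (2 + ε) = c * ε / 2 := by
    rw [hδ_def]; field_simp
  have hδc : δ ≤ c := by
    rw [hδ_def, div_le_iff₀ (by positivity)]
    nlinarith
  have hcδ : 0 ≤ c - δ := by linarith
  have hJtop : Tendsto Jseq atTop atTop := by
    refine tendsto_atTop_mono (fun k => ?_) hK
    have h1 : (Kseq k : ℝ) ≤ (1 + ε) * Kseq k :=
      le_mul_of_one_le_left (Nat.cast_nonneg _) (by linarith)
    exact_mod_cast h1.trans (hJ k)
  have hband : ∀ᶠ K : ℕ in atTop, (c - δ) * K < b K ∧ b K < (c + δ) * K := by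
    have h1 : ∀ᶠ K : ℕ in atTop, b K / K ∈ Set.Ioo (c - δ) (c + δ) :=
      hb.eventually (Ioo_mem_nhds (by linarith) (by linarith))
    filter_upwards [h1, eventually_gt_atTop 0] with K hK hK0
    have hKpos : (0:ℝ) < K := by exact_mod_cast hK0
    rw [Set.mem_Ioo, lt_div_iff₀ hKpos, div_lt_iff₀ hKpos] at hK
    exact hK
  have hlarge : ∀ᶠ k : ℕ in atTop, 2 * M / (c * ε) ≤ (Kseq k : ℝ) :=
    (tendsto_natCast_atTop_atTop.comp hK).eventually_ge_atTop _
  filter_upwards [hK.eventually hband, hJtop.eventually hband, hlarge] with k hKk hJk hMk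
  obtain ⟨-, hK2⟩ := hKk
  obtain ⟨hJ1, -⟩ := hJk
  have h3 : (c - δ) * ((1 + ε) * Kseq k) ≤ (c - δ) * Jseq k :=
    mul_le_mul_of_nonneg_left (hJ k) hcδ
  have key : (c - δ) * ((1 + ε) * (Kseq k : ℝ)) - (c + δ) * Kseq k =
      (c * ε - δ * (2 + ε)) * Kseq k := by ring
  rw [hδε] at key
  have hcε : 0 < c * ε := by positivity
  have hM : 2 * M ≤ (Kseq k : ℝ) * (c * ε) := (div_le_iff₀ hcε).1 hMk
  have hM' : M ≤ (c * ε - c * ε / 2) * Kseq k := by linarith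
  linarith

/-- **Core Tauberian step.** Let `S, g` be positive sequences with `log S_K / K → s log 2`, `s > 0`,
`g(k+2) 2^{3(k+1)} ≤ S_{k+1}` (averaged MMS upper bound at scale `2^k` for the point `2^{k+2} e₁`)
and `S_J ≤ S_{k+2} + 2^{3(J+2)} g(k)` for all `k, J` (MMS lower bound: outside the window `W_{k+2}`
the two-point function is at most its value at `2^k e₁`). Then `log g(k) / k → (s - 3) log 2`.
[folklore] -/
theorem tendsto_log_div_of_windowSum {S g : ℕ → ℝ} {s : ℝ} (hS : ∀ K, 0 < S K)
    (hg : ∀ k, 0 < g k) (hs : 0 < s)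
    (hb : Tendsto (fun K : ℕ => Real.log (S K) / K) atTop (𝓝 (s * Real.log 2)))
    (hU : ∀ k, g (k + 2) * 2 ^ (3 * (k + 1)) ≤ S (k + 1))
    (hL : ∀ k J, S J ≤ S (k + 2) + 2 ^ (3 * (J + 2)) * g k) :
    Tendsto (fun k : ℕ => Real.log (g k) / k) atTop (𝓝 ((s - 3) * Real.log 2)) := by
  set ℓ : ℝ := Real.log 2 with hℓ
  have hℓpos : 0 < ℓ := Real.log_pos one_lt_two
  set f : ℕ → ℝ := fun k => Real.log (g k) / k with hf
  rw [← tendsto_add_atTop_iff_nat 2]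
  -- the denominator `D k = k + 2`
  have hD : ∀ k : ℕ, (0:ℝ) < ((k + 2 : ℕ) : ℝ) := fun k => by positivity
  -- ratio `(k+1)/(k+2) → 1`
  have hr1 : Tendsto (fun k : ℕ => ((k + 1 : ℕ) : ℝ) / ((k + 2 : ℕ) : ℝ)) atTop (𝓝 1) := by
    have h := (tendsto_natCast_div_add_atTop (1:ℝ)).comp (tendsto_add_atTop_nat 1)
    refine h.congr fun k => ?_
    simp only [Function.comp_apply]
    push_cast
    ring_nf
  rw [tendsto_order]
  constructor
  · -- lower bound: `∀ a < (s-3) ℓ`, eventually `a < f (k+2)`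
    intro a ha
    -- choose `ε ∈ (0,1]` with `a < (s-3)(1+ε) ℓ`, by continuity at `ε = 0`
    obtain ⟨ε, hε, haε⟩ : ∃ ε : ℝ, 0 < ε ∧ a < (s - 3) * (1 + ε) * ℓ := by
      have hcont : Tendsto (fun ε : ℝ => (s - 3) * (1 + ε) * ℓ) (𝓝[>] 0)
          (𝓝 ((s - 3) * (1 + 0) * ℓ)) :=
        ((Continuous.tendsto (by fun_prop) 0).mono_left nhdsWithin_le_nhds)
      rw [add_zero, mul_one] at hcont
      have hev := (hcont.eventually_const_lt ha).and (eventually_mem_nhdsWithin (a := (0:ℝ)))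
      obtain ⟨ε, h1, h2⟩ := hev.exists
      exact ⟨ε, h2, h1⟩
    -- the far scale `J k = ⌈(1+ε)(k+4)⌉`
    set J : ℕ → ℕ := fun k => ⌈(1 + ε) * ((k : ℝ) + 4)⌉₊ with hJdef
    have hJge : ∀ k, (1 + ε) * (((k + 4 : ℕ)) : ℝ) ≤ J k := fun k => by
      push_cast; exact Nat.le_ceil _
    have hJle : ∀ k, (J k : ℝ) ≤ (1 + ε) * ((k : ℝ) + 4) + 1 := fun k =>
      (Nat.ceil_lt_add_one (by positivity)).le
    have hJtop : Tendsto J atTop atTop := by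
      refine tendsto_atTop_mono (fun k => ?_) tendsto_id
      have h1 : ((k : ℕ) : ℝ) ≤ (1 + ε) * ((k : ℝ) + 4) := by nlinarith
      have h2 : ((k : ℕ) : ℝ) ≤ ((J k : ℕ) : ℝ) := h1.trans (Nat.le_ceil _)
      exact Nat.cast_le.1 h2
    -- doubling: eventually `S (J k) ≥ 2 S (k+4)`
    have hdbl : ∀ᶠ k in atTop, Real.log (S (k + 4)) + ℓ ≤ Real.log (S (J k)) :=
      eventually_add_le_of_tendsto_div ℓ hb (by positivity) hε (tendsto_add_atTop_nat 4) hJge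
    -- `J k / (k+2) → 1 + ε`
    have hJr : Tendsto (fun k : ℕ => (J k : ℝ) / ((k + 2 : ℕ) : ℝ)) atTop (𝓝 (1 + ε)) := by
      have h4 : Tendsto (fun k : ℕ => (4 : ℝ) / ((k + 2 : ℕ) : ℝ) - 2 / ((k + 2 : ℕ) : ℝ)) atTop
          (𝓝 (0 - 0)) :=
        ((tendsto_const_div_atTop_nhds_zero_nat (4:ℝ)).comp (tendsto_add_atTop_nat 2)).sub
          ((tendsto_const_div_atTop_nhds_zero_nat (2:ℝ)).comp (tendsto_add_atTop_nat 2))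
      rw [sub_zero] at h4
      -- lower: `(1+ε) (k+4)/(k+2) = (1+ε) (1 + 2/(k+2))`; upper adds `1/(k+2)`
      have hlo : Tendsto (fun k : ℕ => (1 + ε) * (1 + (2 : ℝ) / ((k + 2 : ℕ) : ℝ))) atTop
          (𝓝 ((1 + ε) * (1 + 0))) :=
        (((tendsto_const_div_atTop_nhds_zero_nat (2:ℝ)).comp
          (tendsto_add_atTop_nat 2)).const_add 1).const_mul (1 + ε)
      rw [add_zero, mul_one] at hlo
      have hup : Tendsto (fun k : ℕ => (1 + ε) * (1 + (2 : ℝ) / ((k + 2 : ℕ) : ℝ)) +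
          1 / ((k + 2 : ℕ) : ℝ)) atTop (𝓝 ((1 + ε) + 0)) :=
        hlo.add ((tendsto_const_div_atTop_nhds_zero_nat (1:ℝ)).comp (tendsto_add_atTop_nat 2))
      rw [add_zero] at hup
      refine tendsto_of_tendsto_of_tendsto_of_le_of_le' hlo hup ?_ ?_
      · filter_upwards with k
        rw [le_div_iff₀ (hD k)]
        refine le_trans (le_of_eq ?_) (hJge k)
        push_cast
        field_simp
        ring
      · filter_upwards with k
        rw [div_le_iff₀ (hD k)]
        refine (hJle k).trans (le_of_eq ?_)
        push_cast
        field_simp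
        ring
    -- the lower comparison function `v k = (log S (J k) - (3 J k + 7) ℓ) / (k+2) → (s-3)(1+ε) ℓ`
    have hbJ : Tendsto (fun k : ℕ => Real.log (S (J k)) / (J k : ℝ)) atTop (𝓝 (s * ℓ)) :=
      hb.comp hJtop
    have h7 : Tendsto (fun k : ℕ => (7 * ℓ) / ((k + 2 : ℕ) : ℝ)) atTop (𝓝 0) :=
      (tendsto_const_div_atTop_nhds_zero_nat (7 * ℓ)).comp (tendsto_add_atTop_nat 2)
    have hv : Tendsto (fun k : ℕ => (Real.log (S (J k)) - (3 * (J k : ℝ) + 7) * ℓ) /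
        ((k + 2 : ℕ) : ℝ)) atTop (𝓝 ((s - 3) * (1 + ε) * ℓ)) := by
      have h := ((hbJ.mul hJr).sub ((hJr.const_mul (3 * ℓ)))).sub h7
      have hlim : s * ℓ * (1 + ε) - 3 * ℓ * (1 + ε) - 0 = (s - 3) * (1 + ε) * ℓ := by ring
      rw [hlim] at h
      refine h.congr' ?_
      filter_upwards [hJtop.eventually (eventually_gt_atTop 0)] with k hk
      have hJpos : (0:ℝ) < J k := by exact_mod_cast hk
      field_simp
      ring
    filter_upwards [hdbl, hv.eventually_const_lt haε] with k hk1 hk2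
    refine hk2.trans_le ?_
    -- `2 S (k+4) ≤ S (J k)`
    have h2S : 2 * S (k + 4) ≤ S (J k) := by
      have h := Real.exp_le_exp.2 hk1
      rwa [Real.exp_add, Real.exp_log (hS _), Real.exp_log (hS _), hℓ, Real.exp_log two_pos,
        mul_comm] at h
    have hLk := hL (k + 2) (J k)
    have hpow : (2:ℝ) ^ (3 * J k + 7) = 2 * 2 ^ (3 * (J k + 2)) := by
      rw [show 3 * J k + 7 = 3 * (J k + 2) + 1 by ring, pow_succ]; ring
    have hlow : S (J k) / 2 ^ (3 * J k + 7) ≤ g (k + 2) := by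
      rw [div_le_iff₀ (by positivity), hpow]
      have : S (J k) ≤ 2 * (2 ^ (3 * (J k + 2)) * g (k + 2)) := by
        have h4 : (k + 2 + 2) = k + 4 := by ring
        rw [h4] at hLk
        linarith
      linarith
    have hlog : Real.log (S (J k)) - (3 * (J k : ℝ) + 7) * ℓ ≤ Real.log (g (k + 2)) := by
      have h := Real.log_le_log (by have := hS (J k); positivity) hlow
      rw [Real.log_div (hS _).ne' (by positivity), Real.log_pow] at h
      push_cast at h
      linarith
    exact div_le_div_of_nonneg_right hlog (hD k).le
  · -- upper bound: `∀ a > (s-3) ℓ`, eventually `f (k+2) < a`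
    intro a ha
    have hb1 : Tendsto (fun k : ℕ => Real.log (S (k + 1)) / ((k + 1 : ℕ) : ℝ)) atTop
        (𝓝 (s * ℓ)) := hb.comp (tendsto_add_atTop_nat 1)
    have hu : Tendsto (fun k : ℕ => (Real.log (S (k + 1)) - 3 * (((k + 1 : ℕ) : ℝ)) * ℓ) /
        ((k + 2 : ℕ) : ℝ)) atTop (𝓝 ((s - 3) * ℓ)) := by
      have h := (hb1.mul hr1).sub (hr1.const_mul (3 * ℓ))
      have hlim : s * ℓ * 1 - 3 * ℓ * 1 = (s - 3) * ℓ := by ring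
      rw [hlim] at h
      refine h.congr fun k => ?_
      have hk1 : (0:ℝ) < ((k + 1 : ℕ) : ℝ) := by positivity
      field_simp
    filter_upwards [hu.eventually_lt_const ha] with k hk
    refine lt_of_le_of_lt ?_ hk
    have hlog : Real.log (g (k + 2)) ≤ Real.log (S (k + 1)) - 3 * (((k + 1 : ℕ) : ℝ)) * ℓ := by
      have h := Real.log_le_log (by have := hg (k + 2); positivity) (hU k)
      rw [Real.log_mul (hg _).ne' (by positivity), Real.log_pow] at h
      push_cast at h ⊢
      linarith
    exact div_le_div_of_nonneg_right hlog (hD k).le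



end Summit.CriticalPhenomena.Ising3DConformalLimit.Theorems

end
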